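import Literature.AlgebraicGeometry.HodgeTheory.CMHodgeGroupNoTwistThreeMixed
import Literature.AlgebraicGeometry.HodgeTheory.CMHodgeGroupIrreducibleBlocks
import HarnessLib

/-!
# `Lie Hg ⊗ ℂ ⊇ 𝔲_E(V,ψ) ⊗ ℂ` for a CM field of degree `≤ 4` acting with multiplicity `3` and TWO MIXED places, under
# «no Weil-type quadratic element» (the quartic CM patterns `(2,1)+(2,1)`, `(2,1)+(1,2)` off Weil type) — the Lie step of
# «`Hg = U_E`» (Moonen–Zarhin 1999 §2 (2.3); Ribet 1983 Thm. 0)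

Family `hodge`, layer `Literature/AlgebraicGeometry/HodgeTheory` (brick P5, Hodge-structure half, for TABLE X ROW 10 ALL
MEMBERS NOT OF WEIL TYPE, patterns `(2,1)+(2,1)` / `(2,1)+(1,2)`, of the cell `pub-hodgeav-hg6`, req-37 (A) Q2b; the
`dim_E H¹ = 3` companion of `CMHodgeGroupOneBalancedPlace`). UNCONDITIONAL (the Weil-type exclusion is an explicit hypothesis
on the Hodge structure); theorems only, no definition, no named fact, no `sorry`. HONEST FRAMING of that cell: HC / HC_AV /
HC_CM / H2 NOT proved — this file is linear algebra of polarized weight-one `ℚ`-Hodge structures (it reduces the hypothesis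
`hU` of the cell's census row `census_row10_quarticGeneral`, for these members, to «no Weil-type quadratic element»).

ASSEMBLY: `CMThetaSocket.mem_spanC_of_lift_of_centre` (socket) ← LIFT (`CMNoTwist3.lift_of_two_mixed`: Ribet's Lie lemma
at `d = 3` + the envelope of a twist + the arithmetic end, under `hnoWeil`) + CENTRE (`CMThetaCentre.centre_of_pair`:
equal weights `(±1, ±1)`, under `hnoWeil`).
* **`CMThetaThreeTwoMixed.mem_spanC_of_commute_of_skew`** — for an effective polarized weight-one `H` with `End_Hdg(V) = E =
  ℚ[φ]` of dimension `2|ι|`, `|ι| ≤ 2`, every non-zero element invertible, a CM type `μ : ι → ℂ` with all blocks `W_c` of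
  dimension `3` spanning `V_ℂ`, two places `k₁ ≠ k₂`, EVERY place mixed (meeting both `V^{1,0}` and `V^{0,1}`), NO WEIL-TYPE
  QUADRATIC ELEMENT («every non-zero `ψ`-skew `y ∈ E` with `y² ∈ ℚ·1` has `Tr(y_ℂ Θ) ≠ 0»), and ANY bracket-closed
  `𝔤 ⊆ End_ℚ(V)` commuting with `E`, `ψ`-skew, with `Θ ∈ 𝔤_ℂ`: every `φ_ℂ`-commuting `ψ_ℂ`-skew operator lies in `𝔤_ℂ`.
* **`CMThetaThreeTwoMixed.mem_hodgeLieC_of_commute_of_skew`** — the case `𝔤 = Lie Hg(H)`: `Lie Hg(H)_ℂ ⊇ 𝔲_E(V,ψ)_ℂ`.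
(SHARP: for the Weil-type members — `E ⊇ k` imaginary quadratic acting `(3,3)` — the conclusion is false, `Hg ⊆ SU_k`.)

## References
* [MoonenZarhin1999LowDim] B. Moonen, Yu. Zarhin, Math. Ann. 315 (1999), §2 (2.3), (1.8).
* [Ribet1983] K. A. Ribet, Amer. J. Math. 105 (1983), Thm. 0, §3.
* [Deligne1982HodgeCycles] P. Deligne, LNM 900 (1982), I §3 Prop. 3.4, §4 (p. 30).
-/

noncomputable section

open scoped TensorProduct
open Module

namespace Literature.AlgebraicGeometry.Motives

namespace HodgeStructure

universe u

variable {V : Type u} [AddCommGroup V] [Module ℚ V] {n : ℤ}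

/-- **`𝔤_ℂ ⊇ 𝔲_E(V,ψ)_ℂ` FOR A CM FIELD ACTING WITH MULTIPLICITY `3` AND TWO MIXED PLACES, UNDER «NO WEIL-TYPE QUADRATIC
ELEMENT»** (see the module docstring). [cite: MoonenZarhin1999LowDim, §2 (2.3)] [cite: Ribet1983, Thm. 0]
[cite: Deligne1982HodgeCycles, I §3 Prop. 3.4] -/
theorem CMThetaThreeTwoMixed.mem_spanC_of_commute_of_skew [Module.Finite ℚ V] [HodgeTensorFacts.{u, u}] {ι : Type}
    [Fintype ι] [DecidableEq ι] (hι : Fintype.card ι ≤ 2)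
    (H : HodgeStructure V n) (hn : n = 1) (heff : H.IsEffective) (ψ : H.Polarization)
    {φ : Module.End ℚ V} (hφE : φ ∈ H.endAlg) {m : ℕ} (hE : ∀ a ∈ H.endAlg, ∃ q : Fin m → ℚ, a = ∑ k, q k • φ ^ (k : ℕ))
    (hEdim : Module.finrank ℚ H.endAlg = 2 * Fintype.card ι)
    (hdiv : ∀ a ∈ H.endAlg, a ≠ 0 → ∃ b : Module.End ℚ V, b * a = 1)
    (μ : ι → ℂ) (hinj : Function.Injective μ) (hdist : ∀ k k', μ k' ≠ starRingEnd ℂ (μ k))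
    (hrank : ∀ k, Module.finrank ℂ ↥(Module.End.eigenspace (φ.baseChange ℂ) (μ k) ⊓ H.piece 1 0) +
      Module.finrank ℂ ↥(Module.End.eigenspace (φ.baseChange ℂ) (μ k) ⊓ H.piece 0 1) = 3)
    (htop : (⨆ kt : ι × Fin 2, Module.End.eigenspace (φ.baseChange ℂ)
      (if kt.2 = 0 then μ kt.1 else starRingEnd ℂ (μ kt.1))) = ⊤)
    (𝔤 : Submodule ℚ (Module.End ℚ V)) (hbr : ∀ X ∈ 𝔤, ∀ X' ∈ 𝔤, X * X' - X' * X ∈ 𝔤)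
    (hcomm : ∀ X ∈ 𝔤, ∀ a : H.endAlg, X * (a : Module.End ℚ V) = (a : Module.End ℚ V) * X)
    (hskew : ∀ X ∈ 𝔤, ∀ v w, ψ.form (X v) w + ψ.form v (X w) = 0)
    {Θ : Module.End ℂ (ℂ ⊗[ℚ] V)} (hΘ : ∀ p, ∀ x ∈ H.piece p (n - p), Θ x = ((2 * p - n : ℤ) : ℂ) • x)
    (hΘ𝔤 : Θ ∈ spanC 𝔤)
    (hmix : ∀ k, Module.finrank ℂ ↥(Module.End.eigenspace (φ.baseChange ℂ) (μ k) ⊓ H.piece 1 0) ≠ 0 ∧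
      Module.finrank ℂ ↥(Module.End.eigenspace (φ.baseChange ℂ) (μ k) ⊓ H.piece 0 1) ≠ 0)
    (k₁ k₂ : ι) (hk₁₂ : k₁ ≠ k₂)
    (hnoWeil : ∀ y ∈ H.endAlg, y ≠ 0 → (∀ v w, ψ.form (y v) w + ψ.form v (y w) = 0) →
      (∃ q : ℚ, y * y = q • 1) → LinearMap.trace ℂ _ (y.baseChange ℂ * Θ) ≠ 0)
    {Y : Module.End ℂ (ℂ ⊗[ℚ] V)} (hYφ : Y * φ.baseChange ℂ = φ.baseChange ℂ * Y)
    (hYskew : ∀ x y, ψ.form.baseChange ℂ (Y x) y + ψ.form.baseChange ℂ x (Y y) = 0) : Y ∈ spanC 𝔤 := by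
  classical
  have hirr := fun k U hUW hU => CMIrred.eigenspace_irreducible H hn heff ψ hφE hE μ hinj hdist htop 𝔤 hΘ hΘ𝔤 hcomm
    hskew k U hUW hU
  -- the weights are `± 1` at every (mixed) place
  have hwt1 : ∀ k, ((Module.finrank ℂ ↥(Module.End.eigenspace (φ.baseChange ℂ) (μ k) ⊓ H.piece 1 0) : ℤ) -
      Module.finrank ℂ ↥(Module.End.eigenspace (φ.baseChange ℂ) (μ k) ⊓ H.piece 0 1)) ^ 2 = 1 := by
    intro k
    have h3 := hrank k
    obtain ⟨ha, hb⟩ := hmix k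
    have hc : (Module.finrank ℂ ↥(Module.End.eigenspace (φ.baseChange ℂ) (μ k) ⊓ H.piece 1 0) = 1 ∧
          Module.finrank ℂ ↥(Module.End.eigenspace (φ.baseChange ℂ) (μ k) ⊓ H.piece 0 1) = 2) ∨
        (Module.finrank ℂ ↥(Module.End.eigenspace (φ.baseChange ℂ) (μ k) ⊓ H.piece 1 0) = 2 ∧
          Module.finrank ℂ ↥(Module.End.eigenspace (φ.baseChange ℂ) (μ k) ⊓ H.piece 0 1) = 1) := by omega
    rcases hc with ⟨h1, h2⟩ | ⟨h1, h2⟩ <;> rw [h1, h2] <;> norm_num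
  have hwt : ∀ k k', ((Module.finrank ℂ ↥(Module.End.eigenspace (φ.baseChange ℂ) (μ k) ⊓ H.piece 1 0) : ℤ) -
        Module.finrank ℂ ↥(Module.End.eigenspace (φ.baseChange ℂ) (μ k) ⊓ H.piece 0 1)) ^ 2 =
      ((Module.finrank ℂ ↥(Module.End.eigenspace (φ.baseChange ℂ) (μ k') ⊓ H.piece 1 0) : ℤ) -
        Module.finrank ℂ ↥(Module.End.eigenspace (φ.baseChange ℂ) (μ k') ⊓ H.piece 0 1)) ^ 2 := fun k k' => by
    rw [hwt1, hwt1]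
  have hlift := fun k Z hZ => CMNoTwist3.lift_of_two_mixed hι H hn heff ψ hφE hE hdiv μ hinj hdist hrank htop 𝔤 hbr hcomm
    hskew hΘ hΘ𝔤 hirr hmix hwt hnoWeil k Z hZ
  -- `φ† ≠ φ`: `φ†` acts on `W_{μ k₁} ≠ 0` by `conj (μ k₁) ≠ μ k₁`
  have hφadj : ψ.adjoint φ ≠ φ := by
    intro h
    have hfin : Module.finrank ℂ ↥(Module.End.eigenspace (φ.baseChange ℂ) (μ k₁)) = 3 := by
      rw [CMTheta.finrank_eigenspace_eq_add H hn heff hφE, hrank k₁]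
    obtain ⟨w, hw, hw0⟩ := Submodule.exists_mem_ne_zero_of_ne_bot
      (fun h0 => by rw [h0, finrank_bot] at hfin; exact three_ne_zero hfin.symm :
        Module.End.eigenspace (φ.baseChange ℂ) (μ k₁) ≠ ⊥)
    have h1 := CMNoTwist.adjoint_baseChange_apply H hn heff ψ hφE hE μ hinj hdist three_ne_zero hrank htop k₁ w hw
    rw [h, Module.End.mem_eigenspace_iff.1 hw] at h1
    exact hdist k₁ k₁ (smul_left_injective ℂ hw0 h1)
  -- every place is `k₁` or `k₂`
  have huniv : ∀ i, i = k₁ ∨ i = k₂ := by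
    intro i
    by_contra hne
    rw [not_or] at hne
    have h3 : ({i, k₁, k₂} : Finset ι).card = 3 := by
      rw [Finset.card_insert_of_notMem (by simp [hne.1, hne.2]), Finset.card_insert_of_notMem (by simp [hk₁₂]),
        Finset.card_singleton]
    have hle : ({i, k₁, k₂} : Finset ι).card ≤ Fintype.card ι := Finset.card_le_univ _
    omega
  have hbal : ∀ k, k ≠ k₁ → k ≠ k₂ → Module.finrank ℂ ↥(Module.End.eigenspace (φ.baseChange ℂ) (μ k) ⊓ H.piece 1 0) =
      Module.finrank ℂ ↥(Module.End.eigenspace (φ.baseChange ℂ) (μ k) ⊓ H.piece 0 1) := fun k h1 h2 => by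
    rcases huniv k with rfl | rfl
    · exact (h1 rfl).elim
    · exact (h2 rfl).elim
  have ht0 : Module.finrank ℂ ↥(Module.End.eigenspace (φ.baseChange ℂ) (μ k₂) ⊓ H.piece 1 0) ≠
      Module.finrank ℂ ↥(Module.End.eigenspace (φ.baseChange ℂ) (μ k₂) ⊓ H.piece 0 1) := by
    have h := hrank k₂; omega
  have hcentre := CMThetaCentre.centre_of_pair (hι.trans (by norm_num)) H hn heff ψ hφE hE hEdim hdiv hφadj μ hinj hdist
    three_ne_zero hrank htop 𝔤 hcomm hskew hΘ hΘ𝔤 hlift k₁ k₂ hk₁₂ hbal (hwt k₁ k₂) ht0 hnoWeil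
  exact CMThetaSocket.mem_spanC_of_lift_of_centre H hn heff ψ hφE hE μ hinj hdist htop 𝔤 hcomm hskew hlift hcentre
    hYφ hYskew

/-- **`Lie Hg(H)_ℂ ⊇ 𝔲_E(V,ψ)_ℂ` FOR A CM FIELD ACTING WITH MULTIPLICITY `3` AND TWO MIXED PLACES, UNDER «NO WEIL-TYPE
QUADRATIC ELEMENT»** (with `Θ` the Hodge operator of `H`): every `φ_ℂ`-commuting `ψ_ℂ`-skew operator of `V_ℂ` lies in
`Lie Hg(H) ⊗ ℂ` — the hypothesis `hU` of the cell's census rows for these members. [cite: MoonenZarhin1999LowDim, §2 (2.3)]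
[cite: Ribet1983, Thm. 0] [cite: Deligne1982HodgeCycles, I §3 Prop. 3.4] -/
theorem CMThetaThreeTwoMixed.mem_hodgeLieC_of_commute_of_skew [Module.Finite ℚ V] [HodgeTensorFacts.{u, u}] {ι : Type}
    [Fintype ι] [DecidableEq ι] (hι : Fintype.card ι ≤ 2)
    (H : HodgeStructure V n) (hn : n = 1) (heff : H.IsEffective) (ψ : H.Polarization)
    {φ : Module.End ℚ V} (hφE : φ ∈ H.endAlg) {m : ℕ} (hE : ∀ a ∈ H.endAlg, ∃ q : Fin m → ℚ, a = ∑ k, q k • φ ^ (k : ℕ))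
    (hEdim : Module.finrank ℚ H.endAlg = 2 * Fintype.card ι)
    (hdiv : ∀ a ∈ H.endAlg, a ≠ 0 → ∃ b : Module.End ℚ V, b * a = 1)
    (μ : ι → ℂ) (hinj : Function.Injective μ) (hdist : ∀ k k', μ k' ≠ starRingEnd ℂ (μ k))
    (hrank : ∀ k, Module.finrank ℂ ↥(Module.End.eigenspace (φ.baseChange ℂ) (μ k) ⊓ H.piece 1 0) +
      Module.finrank ℂ ↥(Module.End.eigenspace (φ.baseChange ℂ) (μ k) ⊓ H.piece 0 1) = 3)
    (htop : (⨆ kt : ι × Fin 2, Module.End.eigenspace (φ.baseChange ℂ)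
      (if kt.2 = 0 then μ kt.1 else starRingEnd ℂ (μ kt.1))) = ⊤)
    (hmix : ∀ k, Module.finrank ℂ ↥(Module.End.eigenspace (φ.baseChange ℂ) (μ k) ⊓ H.piece 1 0) ≠ 0 ∧
      Module.finrank ℂ ↥(Module.End.eigenspace (φ.baseChange ℂ) (μ k) ⊓ H.piece 0 1) ≠ 0)
    (k₁ k₂ : ι) (hk₁₂ : k₁ ≠ k₂)
    (hnoWeil : ∀ Θ : Module.End ℂ (ℂ ⊗[ℚ] V), (∀ p, ∀ x ∈ H.piece p (n - p), Θ x = ((2 * p - n : ℤ) : ℂ) • x) →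
      ∀ y ∈ H.endAlg, y ≠ 0 → (∀ v w, ψ.form (y v) w + ψ.form v (y w) = 0) →
      (∃ q : ℚ, y * y = q • 1) → LinearMap.trace ℂ _ (y.baseChange ℂ * Θ) ≠ 0)
    {Y : Module.End ℂ (ℂ ⊗[ℚ] V)} (hYφ : Y * φ.baseChange ℂ = φ.baseChange ℂ * Y)
    (hYskew : ∀ x y, ψ.form.baseChange ℂ (Y x) y + ψ.form.baseChange ℂ x (Y y) = 0) : Y ∈ H.hodgeLieC := by
  obtain ⟨Θ, hΘ⟩ := exists_hodgeTheta H
  have hΘ𝔤 : Θ ∈ spanC H.hodgeLie := (hodgeLieC_eq_spanC H) ▸ H.mem_hodgeLieC_of_forall_piece hΘ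
  rw [hodgeLieC_eq_spanC]
  exact CMThetaThreeTwoMixed.mem_spanC_of_commute_of_skew hι H hn heff ψ hφE hE hEdim hdiv μ hinj hdist hrank htop
    H.hodgeLie (fun X hX X' hX' => H.commutator_mem_hodgeLie hX hX') (fun X hX a => H.commute_of_mem_hodgeLie hX a)
    (fun X hX => form_apply_add_eq_zero_of_mem_hodgeLie ψ hX) hΘ hΘ𝔤 hmix k₁ k₂ hk₁₂ (hnoWeil Θ hΘ) hYφ hYskew

end HodgeStructure

end Literature.AlgebraicGeometry.Motives
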